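import Mathlib.Algebra.Field.ULift
import Mathlib.Algebra.Algebra.Equiv
import Mathlib.FieldTheory.IsAlgClosed.AlgebraicClosure

/-!
# Algebraic closedness and algebraic closures transfer along `ULift`

Standard facts, stated across universes (Mathlib's `IsAlgClosed.of_ringEquiv` requires both fields in the SAME
universe):

* `Literature.FieldTheory.AlgClosed.isAlgClosed_of_ringEquiv'` — algebraic closedness transfers along a ring
  isomorphism `k ≃+* k'` with `k : Type u`, `k' : Type v`;
* `isAlgClosed_ulift` — `ULift.{v} k` of an algebraically closed field is algebraically closed;
* `isAlgClosure_ulift` — `ULift.{v} k` of an algebraic closure of `F` is an algebraic closure of `F`;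
* `exists_isAlgClosure_in_succ` — every field `F : Type u` has an algebraic closure in `Type (u+1)`
  (`ULift (AlgebraicClosure F)`).

Use: universe bookkeeping when a construction is carried out over an algebraic closure `F̄ : Type (x+1)` in a
successor universe and has to be instantiated at a field `F : Type 0` (the abc-iut cell's convention of record
for the §6 kits of [IUTchI], L5-lead RULINGS 2026-08-26 «R0a»; see `Literature.IUT.HodgeTheaters.ThetaNFKit`).
No new definitions; proofs only.
-/

namespace Literature.FieldTheory.AlgClosed

universe u v w

/-- **Algebraic closedness transfers along a ring isomorphism across universes**: if `k ≃+* k'` and `k` is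
algebraically closed then so is `k'` (Mathlib's `IsAlgClosed.of_ringEquiv`, restated with `k : Type u`,
`k' : Type v`; same proof: pull a monic irreducible back along `e.symm`, take a root, push it forward); the property "every nonconstant polynomial has a root" is invariant under
isomorphism of fields. [cite: Lang2002, Ch. V §2, Thm 2.5 and Cor 2.9 (algebraic closedness / closure up to isomorphism)] -/
theorem isAlgClosed_of_ringEquiv' {k : Type u} [Field k] {k' : Type v} [Field k'] (e : k ≃+* k')
    [IsAlgClosed k] : IsAlgClosed k' := by
  apply IsAlgClosed.of_exists_root
  intro p _ hp
  have hpe : Polynomial.degree (p.map e.symm.toRingHom) ≠ 0 := by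
    rw [Polynomial.degree_map]
    exact ne_of_gt (Polynomial.degree_pos_of_irreducible hp)
  obtain ⟨x, hx⟩ := IsAlgClosed.exists_root (p.map e.symm.toRingHom) hpe
  refine ⟨e x, ?_⟩
  have h1 : e.toRingHom (Polynomial.eval x (p.map e.symm.toRingHom)) = Polynomial.eval (e x) p := by
    rw [Polynomial.eval_map, Polynomial.hom_eval₂, RingEquiv.toRingHom_comp_symm_toRingHom, Polynomial.eval₂_id]
    rfl
  change Polynomial.eval x _ = 0 at hx
  change Polynomial.eval (e x) p = 0
  rw [← h1, hx, map_zero]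

/-- **`ULift` of an algebraically closed field is algebraically closed** (transfer along `ULift.ringEquiv`).
[cite: Lang2002, Ch. V §2, Thm 2.5 and Cor 2.9 (algebraic closedness / closure up to isomorphism)] -/
theorem isAlgClosed_ulift (k : Type u) [Field k] [IsAlgClosed k] : IsAlgClosed (ULift.{v} k) :=
  isAlgClosed_of_ringEquiv' (ULift.ringEquiv (R := k)).symm

/-- **`ULift` of an algebraic closure is an algebraic closure**: if `k` is an algebraic closure of `F` then so is
`ULift.{v} k` (algebraically closed by `isAlgClosed_ulift`, algebraic over `F` along `ULift.algEquiv`) — an isomorphic copy of an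
algebraic closure is an algebraic closure. [cite: Lang2002, Ch. V §2, Cor 2.6 and Cor 2.9 (existence and uniqueness of the algebraic closure up to isomorphism)] -/
theorem isAlgClosure_ulift (F : Type u) [Field F] (k : Type w) [Field k] [Algebra F k] [IsAlgClosure F k] :
    IsAlgClosure F (ULift.{v} k) where
  isAlgClosed := @isAlgClosed_ulift k _ (IsAlgClosure.isAlgClosed F)
  isAlgebraic := (ULift.algEquiv (R := F) (A := k)).symm.isAlgebraic

/-- **Every field has an algebraic closure one universe up**: for `F : Type u` there is `F̄ : Type (u+1)` with
`Field F̄`, `Algebra F F̄`, `IsAlgClosure F F̄` — namely `ULift.{u+1} (AlgebraicClosure F)` (existence of an algebraic closure,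
transported one universe up). [cite: Lang2002, Ch. V §2, Cor 2.6 (existence of an algebraic closure)] -/
theorem exists_isAlgClosure_in_succ (F : Type u) [Field F] :
    ∃ (Fbar : Type (u + 1)) (_ : Field Fbar) (_ : Algebra F Fbar), IsAlgClosure F Fbar :=
  ⟨ULift.{u + 1} (AlgebraicClosure F), inferInstance, inferInstance, isAlgClosure_ulift F (AlgebraicClosure F)⟩

end Literature.FieldTheory.AlgClosed
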